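import Summits.BirchSwinnertonDyer.BirchSwinnertonDyer.Theorems.SylvesterTwoHeegnerIndexCoupledTelescopeKummerFive
import Literature.NumberTheory.EllipticCurves.JZeroTwoTorsion
import Literature.NumberTheory.EllipticCurves.VariableChangePointsMap
import Literature.NumberTheory.EllipticCurves.VariableChangePoints
import Literature.NumberTheory.EllipticCurves.QuadraticTwistRank
import HarnessLib

/-!
# The COUPLED Cassels–Tate telescope, XX: the «ℚ-Kummer five» of RESIDUE c AT `F := ℚ` for the two
# Sylvester curves — the one-calls from the census prefix (planner D668 (O2))

Crux `UpperOffV0HSYPlus` (stmt-BirchSwinnertonDyer-19804); rows' display RESIDUE c v3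
(`…TailFourOfResidue` p714972 / `…TailSevenOfResidue` p714989), last two conjunct groups («ℚ-Kummer
five» for `A_s = cubeSumCurve (3p²)` with `yA`, and for `B_s = cubeSumCurve p` with `yB`).  File XIX
(`…CoupledTelescopeKummerFive`, p712690) proved them for any curve over a GENERIC number field `F` from
«no rational 2-torsion» + a generator mod torsion (B) / all points torsion (A).  THIS file makes the two
calls at `F := ℚ` from EXACTLY the data of the census prefix ((iii) l.70–89: the minimal models `A`,
`B`, the changes of variables `CA • A = cubeSumCurve (3p²)`, `CB • B = cubeSumCurve p`, the point
`P ∈ B(ℚ)` with `hPinf`/`hPgen` stated through `QuadraticDescent.incl K B`) plus, for `A`, the ONE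
displayed input `htor : ∀ Q : A(ℚ), IsOfFinAddOrder Q` (= Rubin's CM rank-0 triple via
`PublishedFactsTwoPlus`, the rows' call, D625 (R4)):

* the transport theorems are stated over a GENERIC base number field `F` with a bound `[DecidableEq F]`
  (used at `F := ℚ`): at the literal field `ℚ` Mathlib elaborates the group law on `E(ℚ)` (and
  `VariableChange.pointEquiv`) with `instDecidableEqRat` — so does the rows' display — while the generic
  tree lemmas (XIX, `JZero.eq_zero_of_two_smul_eq_zero`) carry the classical instance; the bound instance
  makes the STATEMENTS agree with the display verbatim at `ℚ`, and each proof's first step reverts to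
  the classical instance (`Subsingleton.elim`) before calling XIX;
* `cube_add_ne_zero_sylvester` — `x³ − 432 n² ≠ 0` on `ℚ` for `n = p, 3p²`, prime `p ≠ 2, 3`
  (`2p²`, `18p⁴` are not rational cubes: `v_p = 2, 4 ∉ 3ℤ`) = the input `hb` at `F := ℚ`;
* ★ `kummerFive_of_generator_transport` — B-side: the five for `y := δ_{4^κ}` of `P` transported along
  `C • B = E`; ★ `kummerFive_of_torsion_transport` — A-side: the five for `y := 0`.

Theorem-only (no definition, no named fact);
nothing asserted on 19804; no stub closed; X12.CMAtTwo NOT proved; BSD not claimed for any curve.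
Sources: Silverman AEC VIII.§2, X.4.2; Silverman–Tate Thm. 2.1(a); MEMO-bsd-cm-two §59.2.
-/

-- every Summits module is named `Summit.<Summit>.<Problem>…`: the duplicated component is by design
set_option linter.dupNamespace false
set_option autoImplicit false

noncomputable section

open scoped Classical

open WeierstrassCurve Literature.NumberTheory.EllipticCurves NumberField
  Literature.NumberTheory.EllipticCurves.HuShuYin2019

namespace Summit.BirchSwinnertonDyer.BirchSwinnertonDyer.Theorems.SylvesterTwoCoupledTelescope

section KummerFiveSylvester

/-- Finite order is reflected by injective additive maps. [folklore] -/
theorem isOfFinAddOrder_of_injective {G H : Type*} [AddMonoid G] [AddMonoid H] (f : G →+ H)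
    (hf : Function.Injective f) {x : G} (h : IsOfFinAddOrder (f x)) : IsOfFinAddOrder x := by
  obtain ⟨k, hk, hk0⟩ := h.exists_nsmul_eq_zero
  exact isOfFinAddOrder_iff_nsmul_eq_zero.mpr ⟨k, hk, hf (by rw [map_nsmul, map_zero, hk0])⟩

/-- **`t³ ≠ c` in `ℚ` when the `p`-adic valuation of `c` is not a multiple of `3`.** [folklore] -/
theorem pow_three_ne_of_padicValRat (p : ℕ) [Fact p.Prime] {c : ℚ}
    (h3 : ¬ (3 : ℤ) ∣ padicValRat p c) (t : ℚ) : t ^ 3 ≠ c := by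
  intro h
  apply h3
  refine ⟨padicValRat p t, ?_⟩
  rw [← h, padicValRat.pow t]
  push_cast
  ring

/-- **`2 p²` and `2 (3p²)²` are not rational cubes** for a prime `p ≠ 2, 3` (`v_p = 2`, resp. `4`), hence
`x³ − 432 n² ≠ 0` on `ℚ` for `n = p, 3p²` (`432 = 2·6³`): the input `hb` of the two theorems below at
`F := ℚ`, `E := cubeSumCurve n = ⟨0, 0, 0, 0, −432 n²⟩`. [folklore] -/
theorem cube_add_ne_zero_sylvester {p : ℕ} (hp : p.Prime) (hp2 : p ≠ 2) (hp3 : p ≠ 3) (x : ℚ) :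
    x ^ 3 + -432 * (p : ℚ) ^ 2 ≠ 0 ∧ x ^ 3 + -432 * (3 * (p : ℚ) ^ 2) ^ 2 ≠ 0 := by
  haveI : Fact p.Prime := ⟨hp⟩
  have hp0 : (p : ℚ) ≠ 0 := by exact_mod_cast hp.ne_zero
  have h2v : padicValRat p (2 : ℚ) = 0 := by
    rw [show (2 : ℚ) = ((2 : ℕ) : ℚ) by norm_num, padicValRat.of_nat]
    haveI : Fact (Nat.Prime 2) := ⟨Nat.prime_two⟩
    exact_mod_cast padicValNat_primes hp2
  have h3v : padicValRat p (3 : ℚ) = 0 := by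
    rw [show (3 : ℚ) = ((3 : ℕ) : ℚ) by norm_num, padicValRat.of_nat]
    haveI : Fact (Nat.Prime 3) := ⟨Nat.prime_three⟩
    exact_mod_cast padicValNat_primes hp3
  have hpv : padicValRat p (p : ℚ) = 1 := padicValRat.self hp.one_lt
  have hA : ∀ t : ℚ, t ^ 3 ≠ 2 * (p : ℚ) ^ 2 := fun t ↦ by
    refine pow_three_ne_of_padicValRat p ?_ t
    rw [padicValRat.mul two_ne_zero (pow_ne_zero 2 hp0), padicValRat.pow (p : ℚ), h2v, hpv]
    norm_num
  have hB : ∀ t : ℚ, t ^ 3 ≠ 2 * (3 * (p : ℚ) ^ 2) ^ 2 := fun t ↦ by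
    refine pow_three_ne_of_padicValRat p ?_ t
    have h3p : (3 : ℚ) * (p : ℚ) ^ 2 ≠ 0 := by positivity
    rw [padicValRat.mul two_ne_zero (pow_ne_zero 2 h3p), padicValRat.pow ((3 : ℚ) * (p : ℚ) ^ 2),
      padicValRat.mul (by norm_num) (pow_ne_zero 2 hp0), padicValRat.pow (p : ℚ), h2v, h3v, hpv]
    norm_num
  constructor
  · intro hx
    apply hA (x / 6)
    field_simp
    linear_combination hx
  · intro hx
    apply hB (x / 6)
    field_simp
    linear_combination hx

-- `[DecidableEq F]`: the group law on `E(F)` (Mathlib) and `VariableChange.pointEquiv` take a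
-- `DecidableEq F` instance; binding it (instead of the classical one) makes the statements below
-- elaborate at `F := ℚ` with `instDecidableEqRat`, i.e. EXACTLY as the rows' display does; the proofs
-- revert to the classical instance in their first step (`Subsingleton.elim`).
variable {F : Type} [Field F] [DecidableEq F] [NumberField F] (K : Type) [Field K] [Algebra F K]

/-- **The ℚ-Kummer five of RESIDUE c, B-SIDE — the transport from the census prefix** (module
docstring), stated over a GENERIC base number field `F` (used at `F := ℚ`, `E := cubeSumCurve p`,
`b := −432 p²`, `hb` from `cube_add_ne_zero_sylvester`): from `C • B = E = ⟨0,0,0,0,b⟩` with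
`x³ + b ≠ 0` on `F`, `P ∈ B(F)` non-torsion in `B(K)` and generating `B(F)` modulo torsion (stated through
`QuadraticDescent.incl K B`, the prefix's form), the five Kummer clauses hold for
`y := δ_{4^κ} (pointEquiv B C P transported along C • B = E)`.
[cite: SilvermanAEC2009, §VIII.2 and Thm X.4.2(a)] [cite: SilvermanTate2015, §2.1, Thm. 2.1(a)] -/
theorem kummerFive_of_generator_transport (κ : ℕ) (E B : WeierstrassCurve F) [B.IsElliptic] {b : F}
    (hE : E = ⟨0, 0, 0, 0, b⟩) (hb : ∀ x : F, x ^ 3 + b ≠ 0) (C : VariableChange F) (hC : C • B = E)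
    (P : B.toAffine.Point) (hPinf : ¬ IsOfFinAddOrder (QuadraticDescent.incl K B P))
    (hPgen : ∀ Q : B.toAffine.Point, ∃ m : ℤ, IsOfFinAddOrder
      (QuadraticDescent.incl K B Q - m • QuadraticDescent.incl K B P)) :
    haveI : E.IsElliptic := hC ▸ inferInstance
    kummerMapTorsion E ((2 ^ κ * 2 ^ κ : ℕ) : ℤ) (E.zsmul_geomPoints_surjective_of_charZero
        (Int.natCast_ne_zero.mpr (mul_ne_zero (pow_ne_zero κ two_ne_zero) (pow_ne_zero κ two_ne_zero))))
        (((VariableChange.pointEquiv B C).trans (Affine.Point.congrEquiv hC)) P) ∈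
      selmerGroup E ((2 ^ κ * 2 ^ κ : ℕ) : ℤ) ∧
    torsionH1ToH1 E ((2 ^ κ * 2 ^ κ : ℕ) : ℤ) (kummerMapTorsion E ((2 ^ κ * 2 ^ κ : ℕ) : ℤ)
        (E.zsmul_geomPoints_surjective_of_charZero (Int.natCast_ne_zero.mpr (mul_ne_zero
          (pow_ne_zero κ two_ne_zero) (pow_ne_zero κ two_ne_zero))))
        (((VariableChange.pointEquiv B C).trans (Affine.Point.congrEquiv hC)) P)) = 0 ∧
    (∀ a : ℤ, a • kummerMapTorsion E ((2 ^ κ * 2 ^ κ : ℕ) : ℤ) (E.zsmul_geomPoints_surjective_of_charZero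
        (Int.natCast_ne_zero.mpr (mul_ne_zero (pow_ne_zero κ two_ne_zero) (pow_ne_zero κ two_ne_zero))))
        (((VariableChange.pointEquiv B C).trans (Affine.Point.congrEquiv hC)) P) = 0 →
      ((2 : ℤ) ^ (2 * κ) ∣ a) ∨ kummerMapTorsion E ((2 ^ κ * 2 ^ κ : ℕ) : ℤ)
        (E.zsmul_geomPoints_surjective_of_charZero (Int.natCast_ne_zero.mpr (mul_ne_zero
          (pow_ne_zero κ two_ne_zero) (pow_ne_zero κ two_ne_zero))))
        (((VariableChange.pointEquiv B C).trans (Affine.Point.congrEquiv hC)) P) = 0) ∧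
    (∀ u ∈ selmerGroup E ((2 ^ κ * 2 ^ κ : ℕ) : ℤ), torsionH1ToH1 E ((2 ^ κ * 2 ^ κ : ℕ) : ℤ) u = 0 →
      ∃ a : ℤ, u = a • kummerMapTorsion E ((2 ^ κ * 2 ^ κ : ℕ) : ℤ)
        (E.zsmul_geomPoints_surjective_of_charZero (Int.natCast_ne_zero.mpr (mul_ne_zero
          (pow_ne_zero κ two_ne_zero) (pow_ne_zero κ two_ne_zero))))
        (((VariableChange.pointEquiv B C).trans (Affine.Point.congrEquiv hC)) P)) := by
  obtain rfl : ‹DecidableEq F› = fun a b ↦ Classical.propDecidable (a = b) := Subsingleton.elim _ _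
  haveI : E.IsElliptic := hC ▸ inferInstance
  subst hE
  have hι := QuadraticDescent.incl_injective (K := K) B
  have hθ := ((VariableChange.pointEquiv B C).trans (Affine.Point.congrEquiv hC)).injective
  -- the generator is non-torsion
  have hg : ¬ IsOfFinAddOrder (((VariableChange.pointEquiv B C).trans (Affine.Point.congrEquiv hC)) P) :=
    fun h ↦ hPinf ((QuadraticDescent.incl K B).isOfFinAddOrder (isOfFinAddOrder_of_injective
      ((VariableChange.pointEquiv B C).trans (Affine.Point.congrEquiv hC)).toAddMonoidHom hθ h))
  -- it generates modulo torsion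
  have hgen : ∀ Q : (⟨0, 0, 0, 0, b⟩ : WeierstrassCurve F).toAffine.Point, ∃ m : ℤ, IsOfFinAddOrder
      (Q - m • ((VariableChange.pointEquiv B C).trans (Affine.Point.congrEquiv hC)) P) := by
    intro Q
    obtain ⟨m, hm⟩ := hPgen (((VariableChange.pointEquiv B C).trans (Affine.Point.congrEquiv hC)).symm Q)
    refine ⟨m, ?_⟩
    rw [← map_zsmul, ← map_sub] at hm
    have h1 := ((VariableChange.pointEquiv B C).trans
      (Affine.Point.congrEquiv hC)).toAddMonoidHom.isOfFinAddOrder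
      (isOfFinAddOrder_of_injective _ hι hm)
    rwa [AddEquiv.coe_toAddMonoidHom, map_sub, map_zsmul, AddEquiv.apply_symm_apply] at h1
  exact kummerFive_of_generator _ κ
    (fun Q hQ ↦ JZero.eq_zero_of_two_smul_eq_zero two_ne_zero hb Q hQ) _ hg hgen

/-- **The ℚ-Kummer five of RESIDUE c, A-SIDE — the transport from the census prefix**: over a generic
base number field `F` (used at `F := ℚ`, `E := cubeSumCurve (3p²)`), from `C • A = E = ⟨0,0,0,0,b⟩` with
`x³ + b ≠ 0` and the displayed input «`A(F)` is torsion» (Rubin's CM rank-0 triple at `F = ℚ`, the rows'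
`PublishedFactsTwoPlus` call), the five hold for `y := 0`. [cite: SilvermanAEC2009, §VIII.2 and Thm X.4.2(a)]
[cite: SilvermanTate2015, §2.1, Thm. 2.1(a)] -/
theorem kummerFive_of_torsion_transport (κ : ℕ) (E A : WeierstrassCurve F) [A.IsElliptic] {b : F}
    (hE : E = ⟨0, 0, 0, 0, b⟩) (hb : ∀ x : F, x ^ 3 + b ≠ 0) (C : VariableChange F) (hC : C • A = E)
    (htor : ∀ Q : A.toAffine.Point, IsOfFinAddOrder Q) :
    haveI : E.IsElliptic := hC ▸ inferInstance
    (0 : galH1Torsion E ((2 ^ κ * 2 ^ κ : ℕ) : ℤ)) ∈ selmerGroup E ((2 ^ κ * 2 ^ κ : ℕ) : ℤ) ∧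
    torsionH1ToH1 E ((2 ^ κ * 2 ^ κ : ℕ) : ℤ) 0 = 0 ∧
    (∀ a : ℤ, a • (0 : galH1Torsion E ((2 ^ κ * 2 ^ κ : ℕ) : ℤ)) = 0 →
      ((2 : ℤ) ^ (2 * κ) ∣ a) ∨ (0 : galH1Torsion E ((2 ^ κ * 2 ^ κ : ℕ) : ℤ)) = 0) ∧
    (∀ u ∈ selmerGroup E ((2 ^ κ * 2 ^ κ : ℕ) : ℤ), torsionH1ToH1 E ((2 ^ κ * 2 ^ κ : ℕ) : ℤ) u = 0 →
      ∃ a : ℤ, u = a • (0 : galH1Torsion E ((2 ^ κ * 2 ^ κ : ℕ) : ℤ))) := by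
  obtain rfl : ‹DecidableEq F› = fun a b ↦ Classical.propDecidable (a = b) := Subsingleton.elim _ _
  haveI : E.IsElliptic := hC ▸ inferInstance
  subst hE
  have htor' : ∀ Q : (⟨0, 0, 0, 0, b⟩ : WeierstrassCurve F).toAffine.Point, IsOfFinAddOrder Q := fun Q ↦ by
    have h1 := ((VariableChange.pointEquiv A C).trans
      (Affine.Point.congrEquiv hC)).toAddMonoidHom.isOfFinAddOrder
      (htor (((VariableChange.pointEquiv A C).trans (Affine.Point.congrEquiv hC)).symm Q))
    rwa [AddEquiv.coe_toAddMonoidHom, AddEquiv.apply_symm_apply] at h1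
  exact kummerFive_of_torsion _ κ (fun Q hQ ↦ JZero.eq_zero_of_two_smul_eq_zero two_ne_zero hb Q hQ) htor'

end KummerFiveSylvester

end Summit.BirchSwinnertonDyer.BirchSwinnertonDyer.Theorems.SylvesterTwoCoupledTelescope

end
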